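import Summits.ResolutionOfSingularities.ResolutionOfSingularities.Theorems.MarkedTransferCampaignG1PnegaObligationF33StdNarasimhanStep2
import HarnessLib

/-!
# [OURS · L1 G1 ℘nega-INTERFACE / RESCUE bed-type datum] The Narasimhan `H♭`-data, PART D: the full §9.7 RUN under the «restart at the new
# frontier» reading — step 3, termination and descent (step 2 = PART C `…NarasimhanStep2`) (`ϵ(1) = z w³ + x⁷ w`, Case (I), `H♭ = x⁷ w`, degree `−4`, order clause VIOLATED; `ϵ(2) = z w³`, Case (III),
# `H♭ = z w³`, degree `−2`, order clause met; `ϵ(3) = 0`), the strict lexicographic DESCENT of the top pair `e_x+e_z > e_x+e_w > e_z+e_w`, and the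
# slot demands of the run. By res-type-063 (gen 7); PARTS A/B = `…F33StdNarasimhan` / `…F33StdNarasimhanCells`; carried by res-L1-type-o6.

CARRIER NOTE (res-L1-type-o6 g20): KERNEL by res-type-063 (HOME draft `D/res-type-063/PnegaObligationF33StdNarasimhanRun.draft.lean` sha16
24758646b421c4be, DRAFT READY + CARRY ask extension 2026-08-27T07:20:42Z, TAKING 07:37Z; PART D of the carry order A p509255 / B p510211 / C / D),
summit-side VERBATIM (this note and the by-line clause added). [OURS · L1 G1] replaces the role of: nothing printed beyond what the decl
docstrings cite — the OURS objects of STEP 3 of the Narasimhan run (`eps₂ = ϵ(2)`, `head₂`, `stdExpr₂`, `datum₂`, `datum₂Ord` at a GENERIC placement) and the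
data-level kernels about them (value `zw³`, degree `−2`, Case (III), order clause met, `ϵ(3) = 0` — termination, `run_sum`, strict descent of
the top pair); bed-type DATA for the retyped obligation F3.3 under the RESCUE-SEED O-102 «restart» reading, no printed item; NOT a statement of the manuscript.
HONEST FRAMING. Nothing here is a statement of H. Hironaka's manuscript *Resolution of singularities in positive characteristics*
(2017-03-23, [Hironaka2017], lit key `paper:url-3343fd9e678b`; every printed item is a CANDIDATE [claim: Hironaka2017, status:
under-review]). The data are OURS instances of the printed recipe (`PnegaObligation.HFlatDatum`, p496649) at the GENERIC placement `P ∋` head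
in degree `2`; the «restart» reading (after the top block is exhausted, re-expand `ϵ(i)` and apply Def. 9.12 to its new top data) is the
RESCUE-SEED O-102 reading of Rem. 9.13 (2) (res-plan-2 / res-adj-2), NOT a printed sentence. AI kernel work, weaker than expert review;
nothing here is progress on resolution of singularities in positive characteristic; no verdict on any printed statement.

## The run (char 2, `q = 2`, `y = X 0`; PART B: `ϵ(0) = xz³ + zw³ + x⁷w`, `H♭(ϵ(0)) = xz³`)
* STEP 2: `ϵ(1) = z w³ + x⁷ w` (`ord = 4`), head `g₁ = y² + ϵ(1)` (requires `g₁ ∈ P 2`, i.e. `x z³ ∈ P 2` beyond `g ∈ P 2` — hypothesis `hg₁`).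
  Standard expression `{(e_z+e_w,0,e_w), (e_x+e_w,0,3e_x)}`; top pair `α₁ = e_x+e_w` (`(0,1,0,1) >lex (0,0,1,1)`), `β₁ = 0`, `γ = 3e_x`, `u = 1`;
  `|α₁| = 2 = q`, `|qγ| = 6 ≥ 2q`: Case (I) ONLY. Rem. 9.9: `H♭ = u⁻¹ Δ_{(0,1,0,1)}ϵ(1)·Δ_{(0,6,0,0)}ϵ(1) = x⁶ · x w = x⁷ w` (`C(7,1) = C(7,6) = 7 ≡ 1`);
  `−δ(A,I,0) = 2q − |α₁+qγ| = 4 − 8 = −4`. ORDER clause: `ord ϵ(1) = 4 ≠ 8` — VIOLATED (`not_order_clause₁`): this step is outside the scope of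
  the ORDER reading `F33stdOrd` but inside «II-first»/as printed (Case (I) outside (II): unit-free, `x⁷w ∈ 𝔪⁸`).
* STEP 3: `ϵ(2) = ϵ(1) − x⁷w = z w³`, head `g₂ = y² + z w³` (hypothesis `hg₂ : g₂ ∈ P 2`). One term `(e_z+e_w, 0, e_w)`; `α₂ = e_z+e_w`, `γ = e_w`;
  Case (III) only; `h♭ = Δ_{(0,0,1,1)}·Δ_{(0,0,0,2)}`, `h♭(zw³) = w²·zw = zw³` (fixed), `k̄ = 2`, `H♭ = z w³`, degree `−2`, order clause met;
  `ϵ(3) = 0`: the run TERMINATES, `ϵ(0) = H♭₀ + H♭₁ + H♭₂` (`run_sum`).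
* DESCENT: `toLex (e_z+e_w) < toLex (e_x+e_w) < toLex (e_x+e_z)` — the top pair drops strictly at every step (`topPair_descent`).
* SLOT DEMANDS of the run on a candidate `℘nega`: `xz³ ∈ (−2)`, `x⁷w ∈ (−4)`, `zw³ ∈ (−2)`. SW (class regime `e' = 1`, `m = 2`): steps 1 and 3 ✓ at
  every placement (`Δ_{e_x+e_z} g = z²`, PART B; `Δ_{e_z+e_w} g₂ = w²`, `value₂_mem_sandwichPNega`); step 2 (`x⁷w ∈ ℘nega_sw(−4)`) is NOT
  decided here (its sources are `P(2d)`, `d ≥ 2`, which a generic `P` does not control).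
-/

noncomputable section

set_option linter.dupNamespace false -- mandated namespace of this single-conjunct summit

namespace Summit.ResolutionOfSingularities.ResolutionOfSingularities.Theorems.Campaign.PnegaObligation.NarasimhanDatum

open Literature.AlgebraicGeometry.Hironaka2017 Literature.AlgebraicGeometry.Hironaka2017.S09LLUED
open Literature.AlgebraicGeometry.Hironaka2017.S08UnitMonomial (StandardExpression U46_3_ours)
open Literature.RingTheory.MvPowerSeries (hasseDeriv adicOrder_eq_order)
open Literature.AlgebraicGeometry.Resolution (adicOrder)
open MvPowerSeries (X monomial coeff)

universe u

variable (K : Type u) [Field K] (ℓ : ℕ) (P : ℕ → Ideal (MvPowerSeries (Fin 4) K)) (hg₁ : head₁ K ∈ P 2)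

/-! ## §2 Step 3: `ϵ(2) = z w³`, Case (III), `H♭ = z w³`, degree `−2`; `ϵ(3) = 0` -/

/-- `ϵ(2) = z w³`. [folklore] -/
def eps₂ : MvPowerSeries (Fin 4) K := monomial (nu 0 0 1 3) 1

/-- `g₂ = y² + z w³`. [folklore] -/
def head₂ : MvPowerSeries (Fin 4) K := X 0 ^ 2 + eps₂ K

/-- `ϵ(2) = ϵ(1) − H♭(ϵ(1))`. [folklore] -/
theorem eps₂_eq_sub [CharP K 2] : eps₂ K = eps₁ K - (datum₁ K P hg₁).value := by
  rw [datum₁_value, eps₁, eps₂]; abel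

/-- `ord ϵ(2) = 4`. [folklore] -/
theorem order_eps₂ : (eps₂ K).order = (4 : ℕ) := by
  rw [eps₂, MvPowerSeries.order_monomial_of_ne_zero one_ne_zero, degree_nu]

/-- `ord g₂ = 2`. [folklore] -/
theorem order_head₂ : (head₂ K).order = (2 : ℕ) := by
  have hne : ((X 0 : MvPowerSeries (Fin 4) K) ^ 2).order ≠ (eps₂ K).order := by
    rw [order_X0_sq, order_eps₂]; exact_mod_cast (show (2 : ℕ) ≠ 4 by omega)
  rw [head₂, MvPowerSeries.order_add_of_order_ne hne, order_X0_sq, order_eps₂]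
  exact inf_eq_left.mpr (by exact_mod_cast (show (2 : ℕ) ≤ 4 by omega))

/-- The one-term standard expression of `ϵ(2)` (term `t₂`). [folklore] -/
def stdExpr₂ (ℓ : ℕ) : StandardExpression 2 (X : Fin 4 → MvPowerSeries (Fin 4) K) 1 ℓ (eps₂ K) where
  support := {t₂}
  u := fun _ => 1
  u_mem := fun _ _ => ⟨1, one_pow _⟩
  u_unit_or_zero := fun _ _ => Or.inl isUnit_one
  a_lt := by
    intro t ht i
    rw [Finset.mem_singleton] at ht
    subst ht; fin_cases i <;> simp [t₂]
  b_lt := by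
    intro t ht j
    rw [Finset.mem_singleton] at ht
    subst ht; simp [t₂]
  sum_eq := by
    rw [Finset.sum_singleton, mul_one]
    show eps₂ K = _
    rw [term_eq]
    show eps₂ K = monomial (nu 0 0 1 1 + 2 • (0 : Fin 4 →₀ ℕ) + 2 ^ 1 • nu 0 0 0 1) 1
    rw [t₂_exp]; rfl

/-- The coefficient is non-zero. [folklore] -/
theorem effSupport₂_eq : TopFrontier.effSupport (stdExpr₂ K ℓ).support (stdExpr₂ K ℓ).u = {t₂} :=
  TopFrontier.effSupport_eq_self _ _ fun _ _ => one_ne_zero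
/-- The top term is present. [folklore] -/
theorem t₂_mem : t₂ ∈ TopFrontier.effSupport (stdExpr₂ K ℓ).support (stdExpr₂ K ℓ).u := by rw [effSupport₂_eq]; simp
/-- Trivially the largest pair. [folklore] -/
theorem isGreatest_t₂ : ∀ s ∈ TopFrontier.effSupport (stdExpr₂ K ℓ).support (stdExpr₂ K ℓ).u, TopFrontier.pairKey s ≤ TopFrontier.pairKey t₂ := by
  intro s hs; rw [effSupport₂_eq, Finset.mem_singleton] at hs; subst hs; exact le_rfl
/-- `α₂ = e_z + e_w`. [folklore] -/
theorem alpha₂_eq : TopFrontier.alpha (stdExpr₂ K ℓ).support (stdExpr₂ K ℓ).u = nu 0 0 1 1 :=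
  TopFrontier.alpha_eq_of_isGreatest _ _ (t₂_mem K ℓ) (isGreatest_t₂ K ℓ)
/-- `β₂ = 0`. [folklore] -/
theorem beta₂_eq : TopFrontier.beta (stdExpr₂ K ℓ).support (stdExpr₂ K ℓ).u = 0 :=
  TopFrontier.beta_eq_of_isGreatest _ _ (t₂_mem K ℓ) (isGreatest_t₂ K ℓ)
/-- `m + 1 ≥ 1`. [folklore] -/
theorem frontierLength₂_pos : 0 < TopFrontier.frontierLength (stdExpr₂ K ℓ).support (stdExpr₂ K ℓ).u :=
  (TopFrontier.frontierLength_pos_iff _ _).2 ⟨_, t₂_mem K ℓ⟩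
/-- `γ = e_w`. [folklore] -/
theorem gamma₂_zero_eq : TopFrontier.gamma (stdExpr₂ K ℓ).support (stdExpr₂ K ℓ).u ⟨0, frontierLength₂_pos K ℓ⟩ = nu 0 0 0 1 := by
  have hmem := TopFrontier.gamma_mem_effSupport (T := (stdExpr₂ K ℓ).support) (u := (stdExpr₂ K ℓ).u) ⟨0, frontierLength₂_pos K ℓ⟩
  rw [effSupport₂_eq, Finset.mem_singleton] at hmem
  simpa [t₂] using congrArg (fun t : TopFrontier.ExpTriple 4 => t.2.2) hmem
/-- `u = 1`. [folklore] -/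
theorem u0₂_eq : StdExpr76.u0 (stdExpr₂ K ℓ).support (stdExpr₂ K ℓ).u = 1 := by
  unfold StdExpr76.u0; rw [dif_pos (frontierLength₂_pos K ℓ)]; rfl

/-- §8.3 for `(g₂, ϵ(2), y)`. [folklore] -/
theorem std₂ (P : ℕ → Ideal (MvPowerSeries (Fin 4) K)) (hg₂ : head₂ K ∈ P 2) :
    U46_3_ours 2 (X : Fin 4 → MvPowerSeries (Fin 4) K) (fun f => f ∈ P (2 ^ 1)) 1 (head₂ K) (eps₂ K) (X 0) where
  y_mem := ⟨0, rfl⟩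
  y_pow_eq := by rw [pow_one]; exact (add_sub_cancel_right _ _).symm
  ord_g := by rw [adicOrder_eq_order, order_head₂]; norm_num
  ord_lt := by rw [adicOrder_eq_order, order_eps₂]; exact_mod_cast (show 2 ^ 1 < 4 by norm_num)
  mem52 := by rw [pow_one]; exact hg₂

/-- **The step-3 datum**: `ϵ(2) = z w³`, Case (III) (`0 < |α₂| = 2 ≤ |qγ| = 2 = q`, `|γ| = 1`), depth `5`. [folklore] -/
def datum₂ (P : ℕ → Ideal (MvPowerSeries (Fin 4) K)) (hg₂ : head₂ K ∈ P 2) : HFlatDatum 2 K 4 P where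
  e := 1
  e_pos := one_pos
  depth := 5
  i₀ := 0
  g := head₂ K
  ε0 := eps₂ K
  S := stdExpr₂ K 5
  std := std₂ K P hg₂
  frontier_pos := frontierLength₂_pos K _
  u0_isUnit := by rw [u0₂_eq]; exact isUnit_one
  alpha_ne_zero := by rw [alpha₂_eq]; exact fun h => by simpa using DFunLike.congr_fun h 2
  q_lt_depth := by norm_num
  degree_lt_depth := by rw [alpha₂_eq, beta₂_eq, gamma₂_zero_eq, t₂_exp, degree_nu]; norm_num
  clean₁ := by rw [alpha₂_eq, beta₂_eq, smul_zero, add_zero, head₂, map_add, hasseDeriv_nu_X0_sq K (by norm_num), zero_add]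
  clean₂ := by
    have h2 : 2 ^ 1 • nu 0 0 0 1 = nu 0 0 0 2 := by ext i; fin_cases i <;> simp
    rw [gamma₂_zero_eq, h2, head₂, map_add, hasseDeriv_nu_X0_sq K (by norm_num), zero_add]
  case := HFlat.Case.III (by
    have h2 : 2 ^ 1 • nu 0 0 0 1 = nu 0 0 0 2 := by ext i; fin_cases i <;> simp
    refine ⟨?_, ?_, ?_, ?_⟩
    · rw [alpha₂_eq, beta₂_eq, smul_zero, add_zero, degree_nu]; norm_num
    · rw [alpha₂_eq, beta₂_eq, gamma₂_zero_eq, smul_zero, add_zero, h2, degree_nu, degree_nu]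
    · rw [gamma₂_zero_eq, h2, degree_nu]; norm_num
    · rw [gamma₂_zero_eq, degree_nu])

variable (hg₂ : head₂ K ∈ P 2)

/-- `α₂`. [folklore] -/
theorem datum₂_alpha : (datum₂ K P hg₂).α = nu 0 0 1 1 := alpha₂_eq K _
/-- `β₂`. [folklore] -/
theorem datum₂_beta : (datum₂ K P hg₂).β = 0 := beta₂_eq K _
/-- `γ`. [folklore] -/
theorem datum₂_gamma : (datum₂ K P hg₂).γ₀ = nu 0 0 0 1 := gamma₂_zero_eq K _
/-- `q = 2`. [folklore] -/
theorem datum₂_q : (datum₂ K P hg₂).q = 2 := rfl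
/-- `α₂ + pβ₂ + qγ = (0,0,1,3)`. [folklore] -/
theorem datum₂_exps : (datum₂ K P hg₂).α + 2 • (datum₂ K P hg₂).β + (datum₂ K P hg₂).q • (datum₂ K P hg₂).γ₀ = nu 0 0 1 3 := by
  rw [datum₂_alpha, datum₂_beta, datum₂_gamma, datum₂_q]; ext i; fin_cases i <;> simp

/-- Case (I) fails at step 3. [folklore] -/
theorem not_isCaseI₂ : ¬ IsCaseI (datum₂ K P hg₂).q (datum₂ K P hg₂).γ₀ := by
  unfold IsCaseI; rw [datum₂_gamma, datum₂_q, show 2 • nu 0 0 0 1 = nu 0 0 0 2 by ext i; fin_cases i <;> simp, degree_nu]; omega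
/-- Case (II) fails at step 3. [folklore] -/
theorem not_isCaseII₂ : ¬ IsCaseII 2 (datum₂ K P hg₂).q (datum₂ K P hg₂).α (datum₂ K P hg₂).β := by
  unfold IsCaseII; rw [datum₂_alpha, datum₂_beta, datum₂_q, smul_zero, add_zero, degree_nu]; omega
/-- Every case witness at step 3 is Case (III). [folklore] -/
theorem case₂_eq (c : HFlat.Case 2 (datum₂ K P hg₂).q (datum₂ K P hg₂).α (datum₂ K P hg₂).β (datum₂ K P hg₂).γ₀) : ∃ h, c = HFlat.Case.III h := by
  rcases c with h | h | h
  · exact absurd h (not_isCaseI₂ K P hg₂)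
  · exact absurd h (not_isCaseII₂ K P hg₂)
  · exact ⟨h, rfl⟩

/-- `k̄ = 2` at step 3. [folklore] -/
theorem kBar₂_eq : HFlat.kBar (datum₂ K P hg₂).q (HFlat.bAIII 2 (datum₂ K P hg₂).q (datum₂ K P hg₂).α (datum₂ K P hg₂).β (datum₂ K P hg₂).γ₀) = 2 := by
  unfold HFlat.kBar HFlat.bAIII
  rw [datum₂_exps, degree_nu, datum₂_q]
  norm_num; rfl

section CharTwo
variable [CharP K 2]

/-- `h♭₂(z w³) = Δ_{(0,0,1,1)}(zw³)·Δ_{(0,0,0,2)}(zw³) = w² · z w = z w³` (fixed point). [folklore] -/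
theorem pre₂_eps₂ : HFlat.pre (hasseFamily K 4) 2 2 (nu 0 0 1 1) 0 (nu 0 0 0 1) (eps₂ K) = eps₂ K := by
  have h2 : 2 • nu 0 0 0 1 = nu 0 0 0 2 := by ext i; fin_cases i <;> simp
  have hs1 : nu 0 0 1 3 - nu 0 0 1 1 = nu 0 0 0 2 := by ext i; fin_cases i <;> simp
  have hs2 : nu 0 0 1 3 - nu 0 0 0 2 = nu 0 0 1 1 := by ext i; fin_cases i <;> simp
  have h4 : nu 0 0 0 2 + nu 0 0 1 1 = nu 0 0 1 3 := by ext i; fin_cases i <;> simp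
  unfold HFlat.pre hasseFamily
  rw [smul_zero, add_zero, h2, eps₂, hasseDeriv_monomial_of_le K (nu_le_nu_iff.mpr (by omega)), hasseDeriv_monomial_of_le K (nu_le_nu_iff.mpr (by omega)),
    hs1, hs2, Fin.prod_univ_four, Fin.prod_univ_four, MvPowerSeries.monomial_mul_monomial, h4]
  simp [three_eq_one K]

/-- **`H♭(ϵ(2)) = z w³ = ϵ(2)`**, so `ϵ(3) = 0`. [folklore] -/
theorem datum₂_value : (datum₂ K P hg₂).value = eps₂ K := by
  obtain ⟨hIII, hc⟩ := case₂_eq K P hg₂ (datum₂ K P hg₂).case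
  unfold HFlatDatum.value
  rw [hc]
  show HFlat.caseIII (hasseFamily K 4) 2 (datum₂ K P hg₂).q (datum₂ K P hg₂).α (datum₂ K P hg₂).β (datum₂ K P hg₂).γ₀ (eps₂ K) = _
  unfold HFlat.caseIII
  rw [kBar₂_eq, datum₂_alpha, datum₂_beta, datum₂_gamma, datum₂_q, Function.iterate_succ_apply, Function.iterate_one, pre₂_eps₂, pre₂_eps₂]

/-- **The run terminates: `ϵ(3) = ϵ(2) − H♭(ϵ(2)) = 0`.** [folklore] -/
theorem eps₃_eq_zero : eps₂ K - (datum₂ K P hg₂).value = 0 := by rw [datum₂_value, sub_self]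

/-- **`ϵ(0) = H♭₀ + H♭₁ + H♭₂ = x z³ + x⁷ w + z w³`**: the three slot values of the run add up to `ϵ(0)`. [folklore] -/
theorem run_sum (hg : head K ∈ P 2) : eps K = (datum K P hg).value + (datum₁ K P hg₁).value + (datum₂ K P hg₂).value := by
  rw [datum_value, datum₁_value, datum₂_value, eps_eq, eps₂]; abel

end CharTwo

/-- **`−δ(B,III,0) = −2` at step 3.** [folklore] -/
theorem datum₂_degree : (datum₂ K P hg₂).degree = -2 := by
  obtain ⟨hIII, hc⟩ := case₂_eq K P hg₂ (datum₂ K P hg₂).case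
  unfold HFlatDatum.degree
  rw [hc]
  show HFlat.negDeltaBIII 2 (datum₂ K P hg₂).q (datum₂ K P hg₂).α (datum₂ K P hg₂).β (datum₂ K P hg₂).γ₀ = -2
  unfold HFlat.negDeltaBIII
  rw [kBar₂_eq]
  unfold HFlat.bAIII
  rw [datum₂_exps, degree_nu, datum₂_q]; norm_num

/-- Step 3 meets the order clause (`ord zw³ = 4 = |α₂ + qγ|`). [folklore] -/
def datum₂Ord : HFlatDatumOrd 2 K 4 P where
  toHFlatDatum := datum₂ K P hg₂
  ord_eq := by
    show adicOrder (eps₂ K) = (((datum₂ K P hg₂).α + 2 • (datum₂ K P hg₂).β + (datum₂ K P hg₂).q • (datum₂ K P hg₂).γ₀).degree : ℕ∞)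
    rw [adicOrder_eq_order, order_eps₂, datum₂_exps, degree_nu]

/-! ## §3 The strict lexicographic DESCENT of the top pair along the run; SW at step 3 -/

/-- **INVARIANT DECREASE on this bed datum**: the top pairs of the three steps drop strictly in the lexicographic order of Eq. (76):
`(α₂, β₂) <lex (α₁, β₁) <lex (α₀, β₀)`, i.e. `e_z+e_w < e_x+e_w < e_x+e_z` (all `β = 0`). [folklore] -/
theorem topPair_descent (hg : head K ∈ P 2) :
    toLex (datum₂ K P hg₂).α < toLex (datum₁ K P hg₁).α ∧ toLex (datum₁ K P hg₁).α < toLex (datum K P hg).α := by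
  rw [datum₂_alpha, datum₁_alpha, datum_alpha]
  exact ⟨toLex_a₂_lt_a₃, toLex_a₃_lt⟩

/-- **SW (class regime `e' = 1`, `m = 2`) contains the step-3 value `z w³ = z w · w²` at every placement `P ∋ g₂` in degree 2** (`Δ_{e_z+e_w} g₂ = w²`
is a sandwich-operator image of the live source `g₂`). The step-2 demand `x⁷ w ∈ ℘nega(−4)` is NOT decided here. [folklore] -/
theorem value₂_mem_sandwichPNega [CharP K 2] [CharP (MvPowerSeries (Fin 4) K) 2] : (datum₂ K P hg₂).value ∈ sandwichPNega 2 1 P 2 2 := by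
  obtain ⟨D, hD, hDf⟩ := W12.exists_sandwichOp_hasseDeriv_powerSeries K 2 1 (γ := nu 0 0 1 1) (by intro s; fin_cases s <;> simp)
  have hdeg : (nu 0 0 1 1).degree = 2 := by rw [degree_nu]
  rw [hdeg] at hD
  have hmem : D (head₂ K) ∈ sandwichPNega 2 1 P 2 2 :=
    W12.apply_mem_sandwichPNega 2 1 P 2 2 1 (by norm_num) (by norm_num) (hD.of_le (by norm_num)) (by simpa using hg₂)
  have hsub : nu 0 0 1 3 - nu 0 0 1 1 = nu 0 0 0 2 := by ext i; fin_cases i <;> simp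
  have h4 : nu 0 0 1 1 + nu 0 0 0 2 = nu 0 0 1 3 := by ext i; fin_cases i <;> simp
  rw [hDf, head₂, map_add, hasseDeriv_nu_X0_sq K (by norm_num), zero_add, eps₂, hasseDeriv_monomial_of_le K (nu_le_nu_iff.mpr (by omega)),
    hsub, Fin.prod_univ_four] at hmem
  simp only [nu_zero, nu_one, nu_two, nu_three, Nat.choose_one_right, Nat.choose_self, one_mul, mul_one,
    Nat.cast_ofNat] at hmem
  rw [three_eq_one K] at hmem
  have hval : (datum₂ K P hg₂).value = monomial (nu 0 0 1 1) (1 : K) * monomial (nu 0 0 0 2) 1 := by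
    rw [datum₂_value, eps₂, MvPowerSeries.monomial_mul_monomial, mul_one, h4]
  rw [hval]
  exact Ideal.mul_mem_left _ _ hmem

end Summit.ResolutionOfSingularities.ResolutionOfSingularities.Theorems.Campaign.PnegaObligation.NarasimhanDatum
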